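import Mathlib
import HarnessLib
import Literature.MathematicalPhysics.QuantumLattice.GaugeGroups
import Literature.MathematicalPhysics.QuantumFieldTheory.ConstructiveQFTWave0
import Summits.Ventures.LatticeQCDFlow.Exactness.FlowPushforward
import Summits.Ventures.LatticeQCDFlow.Scaling.EntropyBudgetFlow
import Summits.Ventures.LatticeQCDFlow.Scaling.EntropyBudgetMeasureSU2

/-!
# LatticeQCDFlow / Scaling — the entropy budget of an exact flow, V: layered flows and DEPTH

HONEST FRAMING: exact (Metropolis-corrected) sampling algorithms for lattice gauge theory;
figures of merit are autocorrelation/cost numbers at stated couplings and volumes; no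
continuum-physics claim.

Venture `LatticeQCDFlow` (cell pub-lqcd), topic `Scaling`, THEORY-2.md §3.2 (h) / §4 rows T2-AG(m),
T2-AI(m) (theory seat GEN-10).  Step two of the flow dictionary, as a theorem: a flow built from
`n` LAYERS (a list of measurable bijections `Fᵢ : Ω ≃ᵐ Ω`, each with an exact real Jacobian
density `jᵢ > 0` w.r.t. the reference `η`, `Exactness.HasJacobian`) is a flow with exact Jacobian
`∏ᵢ jᵢ` (evaluated along the orbit; `HasJacobian.comp`: Jacobians multiply, log-dets add), and a
PER-LAYER volume-contraction clamp `1/jᵢ ≤ K` gives the composite the clamp `K ^ n`.  Hence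

* `layersEquiv`, `layersJac` — the composite flow (first layer applied first) and its Jacobian;
  `layersJac_pos`, `measurable_layersJac`, `layersJac_inv_le` (`1/j ≤ K ^ n`),
  `hasJacobian_layers`;
* `essM_layers_le` — **`ESS(μ, (F_n ∘ ⋯ ∘ F_1)_*(r·η)) ≤ M · K^n · exp(−D(μ ‖ η))`** for a prior
  density `0 < r ≤ M`: the model's log-capacity is at most `log M + n·log K`;
* `Lattice.SU2.essM_layers_volume_law_two` — for `SU(2)` lattice gauge theory on `L^d` (product
  Haar reference, Wilson action, fundamental representation), UNCONDITIONALLY: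
  `ESS ≤ M · K^n · e^{c·L^d} · β^{−3((d−1)L^d(1/2 − 1/L) − 1/2)}`;
* `Lattice.SU2.depth_lower_bound_two` — **THE DEPTH LAW**: if such an `n`-layer exact sampler keeps
  `ESS ≥ e^{−t}` then `n·log K + log M ≥ 3((d−1)L^d(1/2 − 1/L) − 1/2)·log β − c·L^d − t`; i.e. at
  a fixed per-layer clamp `K` the number of layers must grow like `(3/2)(d−1)·L^d·log β / log K` —
  EXTENSIVE in the volume, LOGARITHMIC in the coupling (T4 `ExactnessVsExpressivity`,
  `VolumeScalingOfTraining`, capacity half).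

What is NOT formalised: that a concrete gauge-equivariant coupling layer acting on `V_a` links with
a per-link log-Jacobian clamp `ℓ` has `K ≤ e^{V_a·ℓ}` (needs the Haar volume form on the Lie group;
`Exactness/FlowPushforward.lean` header) — with it the depth law reads
`n·V_a·ℓ ≥ (3/2)(d−1)L^d(1 − 2/L)·log β − …` (THEORY-2.md §3.2 (h)).  References as in Parts III–IV.
-/

namespace Summit.Ventures.LatticeQCDFlow.Theory2

open MeasureTheory InformationTheory Summit.Ventures.LatticeQCDFlow.Exactness
open scoped ENNReal

variable {Ω : Type*} [MeasurableSpace Ω]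

/-- The composite flow of a list of layers `(Fᵢ, jᵢ)`, the head applied FIRST. -/
def layersEquiv : List ((Ω ≃ᵐ Ω) × (Ω → ℝ)) → (Ω ≃ᵐ Ω)
  | [] => MeasurableEquiv.refl Ω
  | l :: ls => l.1.trans (layersEquiv ls)

/-- The Jacobian density of the composite flow: `j_{l :: ls}(z) = j_{ls}(F_l z) · j_l(z)`. -/
def layersJac : List ((Ω ≃ᵐ Ω) × (Ω → ℝ)) → Ω → ℝ
  | [] => fun _ => 1
  | l :: ls => fun z => layersJac ls (l.1 z) * l.2 z

/-- The composite Jacobian is positive if every layer's is. -/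
theorem layersJac_pos : ∀ (ls : List ((Ω ≃ᵐ Ω) × (Ω → ℝ))),
    (∀ l ∈ ls, ∀ z, 0 < l.2 z) → ∀ z, 0 < layersJac ls z
  | [], _, _ => by simp [layersJac]
  | l :: ls, h0, z => by
    simp only [layersJac]
    exact mul_pos (layersJac_pos ls (fun l' hl' => h0 l' (List.mem_cons_of_mem _ hl')) _)
      (h0 l List.mem_cons_self z)

/-- The composite Jacobian is measurable if every layer's is. -/
theorem measurable_layersJac : ∀ (ls : List ((Ω ≃ᵐ Ω) × (Ω → ℝ))),
    (∀ l ∈ ls, Measurable l.2) → Measurable (layersJac ls)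
  | [], _ => by simp only [layersJac]; exact measurable_const
  | l :: ls, hm => by
    simp only [layersJac]
    exact ((measurable_layersJac ls fun l' hl' => hm l' (List.mem_cons_of_mem _ hl')).comp
      l.1.measurable).mul (hm l List.mem_cons_self)

/-- **Contraction clamps multiply**: a per-layer clamp `1/jᵢ ≤ K` gives `1/j ≤ K ^ n` for the
composite of `n` layers. -/
theorem layersJac_inv_le {K : ℝ} : ∀ (ls : List ((Ω ≃ᵐ Ω) × (Ω → ℝ))),
    (∀ l ∈ ls, ∀ z, 0 < l.2 z) → (∀ l ∈ ls, ∀ z, (l.2 z)⁻¹ ≤ K) →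
      ∀ z, (layersJac ls z)⁻¹ ≤ K ^ ls.length
  | [], _, _, _ => by simp [layersJac]
  | l :: ls, h0, hK, z => by
    have h0' : ∀ l' ∈ ls, ∀ z, 0 < l'.2 z := fun l' hl' => h0 l' (List.mem_cons_of_mem _ hl')
    have hK' : ∀ l' ∈ ls, ∀ z, (l'.2 z)⁻¹ ≤ K := fun l' hl' => hK l' (List.mem_cons_of_mem _ hl')
    have hKnn : 0 ≤ K := (inv_pos.mpr (h0 l List.mem_cons_self z)).le.trans
      (hK l List.mem_cons_self z)
    simp only [layersJac, List.length_cons, pow_succ, mul_inv]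
    exact mul_le_mul (layersJac_inv_le ls h0' hK' _) (hK l List.mem_cons_self z)
      (inv_nonneg.mpr (h0 l List.mem_cons_self z).le) (pow_nonneg hKnn _)

/-- **Layers compose into a flow with exact Jacobian** (`HasJacobian.comp` iterated). -/
theorem hasJacobian_layers (η : Measure Ω) : ∀ (ls : List ((Ω ≃ᵐ Ω) × (Ω → ℝ))),
    (∀ l ∈ ls, HasJacobian η l.1 fun z => ENNReal.ofReal (l.2 z)) → (∀ l ∈ ls, ∀ z, 0 < l.2 z) →
      HasJacobian η (layersEquiv ls) fun z => ENNReal.ofReal (layersJac ls z)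
  | [], _, _ => by
    refine ⟨(MeasurableEquiv.refl Ω).measurable, by simp only [layersJac]; exact measurable_const,
      ?_⟩
    have hid : (⇑(MeasurableEquiv.refl Ω) : Ω → Ω) = id := rfl
    simp only [layersJac, layersEquiv, ENNReal.ofReal_one, withDensity_const, one_smul, hid,
      Measure.map_id]
  | l :: ls, hJ, h0 => by
    have h0' : ∀ l' ∈ ls, ∀ z, 0 < l'.2 z := fun l' hl' => h0 l' (List.mem_cons_of_mem _ hl')
    have hls := hasJacobian_layers η ls (fun l' hl' => hJ l' (List.mem_cons_of_mem _ hl')) h0'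
    have hc := hls.comp (hJ l List.mem_cons_self)
    have hfun : (fun z => ENNReal.ofReal (layersJac (l :: ls) z)) = fun z =>
        ENNReal.ofReal (layersJac ls (l.1 z)) * ENNReal.ofReal (l.2 z) := by
      funext z
      simp only [layersJac]
      exact ENNReal.ofReal_mul (layersJac_pos ls h0' _).le
    rw [hfun]
    exact ⟨(l.1.trans (layersEquiv ls)).measurable, hc.measurable_jac, hc.map_eq⟩

/-- **T2-AG for LAYERED flows (`log M + n·log K` budget).**  Probability measures `μ ≪ η` with
`llr μ η ∈ L¹(μ)`; `n` layers with exact Jacobians `ofReal ∘ jᵢ`, `jᵢ > 0` measurable, per-layer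
contraction clamp `1/jᵢ ≤ K`; prior density measurable `0 < r ≤ M`.  Then
`ESS(μ, (layers)_*(r·η)) ≤ M · K^n · exp(−D(μ ‖ η))`. [folklore] -/
theorem essM_layers_le (η μ : Measure Ω) [IsProbabilityMeasure η] [IsProbabilityMeasure μ]
    (hμη : μ ≪ η) (hllr : Integrable (llr μ η) μ) (ls : List ((Ω ≃ᵐ Ω) × (Ω → ℝ)))
    (hJ : ∀ l ∈ ls, HasJacobian η l.1 fun z => ENNReal.ofReal (l.2 z))
    (hm : ∀ l ∈ ls, Measurable l.2) (h0 : ∀ l ∈ ls, ∀ z, 0 < l.2 z) {K : ℝ}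
    (hK : ∀ l ∈ ls, ∀ z, (l.2 z)⁻¹ ≤ K) {r : Ω → ℝ} (hr : Measurable r) (hr0 : ∀ z, 0 < r z)
    {M : ℝ} (hrM : ∀ z, r z ≤ M) :
    essM μ (Measure.map (layersEquiv ls) (η.withDensity fun z => ENNReal.ofReal (r z))) ≤
      M * K ^ ls.length * Real.exp (-(klDiv μ η).toReal) :=
  essM_flow_le η μ hμη hllr (hasJacobian_layers η ls hJ h0) (measurable_layersJac ls hm)
    (layersJac_pos ls h0) (layersJac_inv_le ls h0 hK) hr hr0 hrM

end Summit.Ventures.LatticeQCDFlow.Theory2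

/-! ## On the lattice: the depth law for `SU(2)` -/

noncomputable section

namespace Summit.Ventures.LatticeQCDFlow.Theory2.Lattice

open MeasureTheory InformationTheory Summit.Ventures.LatticeQCDFlow.Exactness
open Literature.MathematicalPhysics.QuantumLattice Literature.MathematicalPhysics.QuantumFieldTheory
open scoped ENNReal

/-- **Volume × coupling law for LAYERED exact flow samplers of `SU(2)`, UNCONDITIONAL.**  For
every `d` there is `c` such that for all `L ≥ 2`, `β ≥ 1`, every list of `n` layers on
`GaugeConfig d L SU(2)` (exact Jacobians w.r.t. product Haar, per-layer contraction clamp `K`) and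
every prior density `0 < r ≤ M`: `ESS ≤ M · K^n · e^{c·L^d} · β^{−3((d−1)L^d(1/2 − 1/L) − 1/2)}`.
[folklore] -/
theorem SU2.essM_layers_volume_law_two (d : ℕ) :
    ∃ c : ℝ, ∀ (L : ℕ) [NeZero L], 2 ≤ L → ∀ β : ℝ, 1 ≤ β →
      ∀ (ls : List ((GaugeConfig d L (Matrix.specialUnitaryGroup (Fin 2) ℂ) ≃ᵐ
          GaugeConfig d L (Matrix.specialUnitaryGroup (Fin 2) ℂ)) ×
          (GaugeConfig d L (Matrix.specialUnitaryGroup (Fin 2) ℂ) → ℝ)))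
        (r : GaugeConfig d L (Matrix.specialUnitaryGroup (Fin 2) ℂ) → ℝ) (K M : ℝ),
        (∀ l ∈ ls, HasJacobian (Measure.pi fun _ : Edge d L =>
            haarProbability (Matrix.specialUnitaryGroup (Fin 2) ℂ)) l.1
          fun V => ENNReal.ofReal (l.2 V)) →
        (∀ l ∈ ls, Measurable l.2) → (∀ l ∈ ls, ∀ V, 0 < l.2 V) →
        (∀ l ∈ ls, ∀ V, (l.2 V)⁻¹ ≤ K) →
        Measurable r → (∀ V, 0 < r V) → (∀ V, r V ≤ M) →
          essM (wilsonMeasure (d := d) (L := L) (fundamentalRep (Fin 2)) β)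
              (Measure.map (layersEquiv ls) ((Measure.pi fun _ : Edge d L =>
                  haarProbability (Matrix.specialUnitaryGroup (Fin 2) ℂ)).withDensity
                fun V => ENNReal.ofReal (r V))) ≤
            M * K ^ ls.length * Real.exp (c * (L : ℝ) ^ d) *
              β ^ (-(3 * (((d : ℝ) - 1) * (L : ℝ) ^ d * (1 / 2 - 1 / L) - 1 / 2))) := by
  obtain ⟨c, hc⟩ := SU2.essM_flow_volume_law_two d
  refine ⟨c, fun L _ hL β hβ ls r K M hJ hm h0 hK hr hr0 hrM => ?_⟩
  exact hc L hL β hβ (layersEquiv ls) (layersJac ls) r (K ^ ls.length) M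
    (hasJacobian_layers _ ls hJ h0) (measurable_layersJac ls hm) (layersJac_pos ls h0)
    (layersJac_inv_le ls h0 hK) hr hr0 hrM

/-- **THE DEPTH LAW (`SU(2)`, unconditional).**  If an exact sampler built from `n` layers with
per-layer volume-contraction clamp `K` and a prior of density `≤ M` keeps `ESS ≥ e^{−t}` for the
`SU(2)` Wilson measure at coupling `β ≥ 1` on the `L^d` torus (`L ≥ 2`), then
`n · log K + log M ≥ 3((d−1)L^d(1/2 − 1/L) − 1/2) · log β − c · L^d − t`. [folklore] -/
theorem SU2.depth_lower_bound_two (d : ℕ) :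
    ∃ c : ℝ, ∀ (L : ℕ) [NeZero L], 2 ≤ L → ∀ β : ℝ, 1 ≤ β →
      ∀ (ls : List ((GaugeConfig d L (Matrix.specialUnitaryGroup (Fin 2) ℂ) ≃ᵐ
          GaugeConfig d L (Matrix.specialUnitaryGroup (Fin 2) ℂ)) ×
          (GaugeConfig d L (Matrix.specialUnitaryGroup (Fin 2) ℂ) → ℝ)))
        (r : GaugeConfig d L (Matrix.specialUnitaryGroup (Fin 2) ℂ) → ℝ) (K M t : ℝ),
        (∀ l ∈ ls, HasJacobian (Measure.pi fun _ : Edge d L =>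
            haarProbability (Matrix.specialUnitaryGroup (Fin 2) ℂ)) l.1
          fun V => ENNReal.ofReal (l.2 V)) →
        (∀ l ∈ ls, Measurable l.2) → (∀ l ∈ ls, ∀ V, 0 < l.2 V) →
        (∀ l ∈ ls, ∀ V, (l.2 V)⁻¹ ≤ K) → 0 < K →
        Measurable r → (∀ V, 0 < r V) → (∀ V, r V ≤ M) →
          Real.exp (-t) ≤ essM (wilsonMeasure (d := d) (L := L) (fundamentalRep (Fin 2)) β)
              (Measure.map (layersEquiv ls) ((Measure.pi fun _ : Edge d L =>
                  haarProbability (Matrix.specialUnitaryGroup (Fin 2) ℂ)).withDensity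
                fun V => ENNReal.ofReal (r V))) →
            3 * (((d : ℝ) - 1) * (L : ℝ) ^ d * (1 / 2 - 1 / L) - 1 / 2) * Real.log β -
                c * (L : ℝ) ^ d - t ≤ (ls.length : ℝ) * Real.log K + Real.log M := by
  obtain ⟨c, hc⟩ := SU2.essM_layers_volume_law_two d
  refine ⟨c, fun L _ hL β hβ ls r K M t hJ hm h0 hK hK0 hr hr0 hrM hess => ?_⟩
  have hβ0 : 0 < β := one_pos.trans_le hβ
  have hM : 0 < M := (hr0 fun _ => 1).trans_le (hrM fun _ => 1)
  have hKn : 0 < K ^ ls.length := pow_pos hK0 _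
  have h := hess.trans (hc L hL β hβ ls r K M hJ hm h0 hK hr hr0 hrM)
  have hlog := Real.log_le_log (Real.exp_pos _) h
  rw [Real.log_exp, Real.log_mul (by positivity) (Real.rpow_pos_of_pos hβ0 _).ne',
    Real.log_mul (by positivity) (Real.exp_pos _).ne', Real.log_mul hM.ne' hKn.ne',
    Real.log_exp, Real.log_rpow hβ0, Real.log_pow] at hlog
  linarith

end Summit.Ventures.LatticeQCDFlow.Theory2.Lattice

end
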